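import Literature.AlgebraicGeometry.HodgeTheory.MiddleDimensionReductionOfHodgeModels
import Literature.AlgebraicGeometry.HodgeTheory.CupPreservesHodgeTypeOfDeRham
import HarnessLib

/-!
# Reduction of the Hodge conjecture to the middle dimension: BFNP Lemma 48 from named facts only

Family `hodge`, layer `Literature/AlgebraicGeometry/HodgeTheory`. Companion of the named fact
`middleDimensionReduction` (file `MiddleDimensionReduction`; P. Brosnan, H. Fang, Z. Nie,
G. Pearlstein, *Singularities of admissible normal functions*, Invent. Math. 177 (2009), §6
**Lemma 48**, arXiv:0711.0964 p. 13: the Hodge conjecture for all smooth projective complex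
varieties is equivalent to its middle-degree case on even-dimensional ones), assembling

* `middleDimensionReduction_of_nonempty_hodgeModel` (`MiddleDimensionReductionOfHodgeModels`: the
  named fact from Hodge models, the independence of `H^{p,q}` from the model, and the Hodge
  compatibility of cup products `CupPreservesHodgeType` — the Gysin side of the printed proof being
  the tree's constructed `complexGysin`), and
* `cupPreservesHodgeType_of_nonempty_hodgeModel` (`CupPreservesHodgeTypeOfDeRham`:
  `CupPreservesHodgeType n X` from the same two named facts and de Rham's theorem in its
  multiplicative form, Voisin I Thm. 5.29 / Warner Thm. 5.45),

into `middleDimensionReduction_of_exists_deRhamIsoFamily`: **the named fact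
`middleDimensionReduction` follows from three named facts of the tree and nothing else** —

1. `nonempty_hodgeModel n X` for all smooth projective `X` (`HodgeModelExistence`: the
   analytification of `X` with a natural de Rham comparison and the Hodge decomposition; Serre
   GAGA §2, de Rham, Hodge — reduced in `HodgeModelExistenceDischarge` / `ComplexifiedDeRhamFamily`
   to de Rham's theorem, the Kähler property of projective manifolds and the Hodge decomposition of
   compact Kähler manifolds);
2. `hodgePQ_independent_of_hodgeModel` (`HodgeFiltrationModels`: all Hodge models cut out the same
   `H^{p,q}`; reduced in `HodgeFiltrationModelsRigidity` to `NaturalDeRhamComparisonRigidity`);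
3. `Literature.NumberTheory.Transcendental.exists_deRhamIsoFamily 𝓘(ℝ, E)` for every
   finite-dimensional complex model space `E` (`Transcendental/DeRhamTheorem`: de Rham's theorem,
   natural, multiplicative and normalised; Warner Thm. 5.36 / 5.45).

The discharge `middleDimensionReduction_holds` is therefore the one-liner
`middleDimensionReduction_of_exists_deRhamIsoFamily ‹1› ‹2› ‹3›` as soon as these land. No named
fact is introduced here.

## References

* [BrosnanFangNiePearlstein2009] P. Brosnan, H. Fang, Z. Nie, G. Pearlstein, Singularities of
  admissible normal functions, Invent. Math. 177 (2009), §6 Lemma 48 (arXiv:0711.0964, p. 13).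
* [VoisinHodgeI2002] C. Voisin, Hodge Theory and Complex Algebraic Geometry I, §5.3.2 Thm. 5.29,
  §7.1.2, §7.3.2.
* [WarnerGTM94] F. W. Warner, Foundations of Differentiable Manifolds and Lie Groups, Thm. 5.36,
  Thm. 5.45.
-/

noncomputable section

open scoped Manifold

namespace Literature.AlgebraicGeometry.HodgeTheory

section HodgeTheory

/-- **BFNP Lemma 48 from named facts only.** Granted (1) Hodge models of all smooth projective
complex varieties (`nonempty_hodgeModel`), (2) the independence of `H^{p,q}` from the Hodge model
(`hodgePQ_independent_of_hodgeModel`) and (3) de Rham's theorem in its multiplicative form on the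
manifolds charted on every finite-dimensional complex model space (`exists_deRhamIsoFamily`), the
named fact `middleDimensionReduction` holds: if every rational middle-degree Hodge class on every
even-dimensional smooth projective complex variety is algebraic, then every rational `(p, p)`-class
on every smooth projective complex variety is algebraic. (The cup-product compatibility needed by
the product half `X × ℙ^{n−2p}` is `cupPreservesHodgeType_of_nonempty_hodgeModel`; the pull-back
compatibility needed by both halves is `preservesHodgeType_of_nonempty_hodgeModel`; Gysin maps,
Poincaré duality, supports and Thom–Gysin exactness are theorems of the tree.)
[cite: BrosnanFangNiePearlstein2009, §6 Lemma 48] [cite: VoisinHodgeI2002, §5.3.2 Thm. 5.29 and §7.3.2] -/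
theorem middleDimensionReduction_of_exists_deRhamIsoFamily
    (hA : ∀ ⦃n : ℕ⦄ ⦃X : Motives.SchemeOver ℂ⦄, nonempty_hodgeModel n X)
    (hI : hodgePQ_independent_of_hodgeModel)
    (hdR : ∀ (E : Type) [NormedAddCommGroup E] [NormedSpace ℂ E] [FiniteDimensional ℂ E],
      Literature.NumberTheory.Transcendental.exists_deRhamIsoFamily 𝓘(ℝ, E)) :
    middleDimensionReduction :=
  middleDimensionReduction_of_nonempty_hodgeModel hA hI
    fun _ _ hX ↦ cupPreservesHodgeType_of_nonempty_hodgeModel hI (@hA _ _) hdR hX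

end HodgeTheory

end Literature.AlgebraicGeometry.HodgeTheory

end
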